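import Summits.BirchSwinnertonDyer.BirchSwinnertonDyer.Theorems.CMKolyvaginAtInertTwoRationalDescentAtTwoDual
import Summits.BirchSwinnertonDyer.BirchSwinnertonDyer.Theorems.CMKolyvaginAtInertTwoReciprocityFamilyAtTwo
import Summits.BirchSwinnertonDyer.BirchSwinnertonDyer.Theorems.SchneiderFreeAdditiveX3PoitouTateReciprocitySumHolds
import Literature.NumberTheory.EllipticCurves.SelmerProofs
import Literature.NumberTheory.EllipticCurves.BSDSelmerCMPConverseRankOneProofs
import Literature.NumberTheory.EllipticCurves.PointDivisibilityProofs
import Literature.NumberTheory.EllipticCurves.HeegnerPointsKolyvaginSelmerProofs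
import HarnessLib

/-!
# Route `CMKolyvaginAtInertTwo`, crux `CMKolyvaginExactAtInertTwo` (stmt-BirchSwinnertonDyer-24277):
# THE `M₀ = 0` CASE ON H₂ FOR A PRIME HEEGNER FIELD, modulo the point-system DATA and the two
# PLUMBING binders ONLY — Poitou–Tate and the reciprocity family are now theorems

Seat `bsd-line-cmk2-p1` g9 (cell `bsd-print-cf2`); helper (`--supports stmt-BirchSwinnertonDyer-24277`).
THEOREMS ONLY (no definition, no named fact, no instance, no `sorry`); no item is closed; BSD is not
proved by this.

g8's `KolyvaginRatDescentTwo.selmer_two_eq_zero_or_eq_kummer_of_cmInert_prime_discr_of_plumbing` (p632849)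
gives, ON H₂ (`HasCM`, `CMInert W 2`, `ρ̄₂` onto) with `K = ℚ(√−q)` a PRIME Heegner field and
`y_K ∉ 2E(K)`: `Sel₂(E/K) ⊆ {0, δ₂ y_K}`, from the inputs (a) `hPT : poitouTate_selmerStructure_duality_real ℚ`
— labelled PRINT there, but a THEOREM of the tree (cell `bsd-schneider`,
`SchneiderFreeAdditiveX3.PoitouTateReduction.poitouTate_selmerStructure_duality_real_holds`, unconditional
for `K : Type`); (b) the machine's reciprocity family `R : ReciprocityFamily (W.conductorNorm ℤ) W K 2 (CMInert W)`
— ty2 DATA there, a THEOREM now (`KolyvaginReciprocityTwo.nonempty_reciprocityFamily_two_cmInert`, this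
seat, p634537); (c) the point-system DATA `D : PointSystemFamily …` (item (0b), OPEN); (d) the two
PLUMBING binders (tower), (desc-fin) (ty2 g22, in progress).

* §1 `selmer_two_eq_zero_or_eq_kummer_of_cmInert_prime_discr_of_pointSystem` — g8's statement with (a)
  and (b) DISCHARGED: modulo exactly {(c) `D`, (d) (tower), (desc-fin)}.
* §2 `natCard_primaryComponent_sha_eq_one_of_selmer_subset_pair` — generic, any elliptic curve over a
  number field, any prime `p`: `Sel_p(E/K) ⊆ {0, δ_p P}` ⟹ `#Ш(E/K)[p^∞] = 1` (the Kummer class dies in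
  `H¹(K, E)`, `torsionH1ToH1_kummerMapTorsion`; the image of `Sel_p` there is `Ш ∩ H¹(K,E)[p]`,
  `map_torsionH1ToH1_selmerGroup_holds`, Silverman X.4.2 (a); a `p`-primary group without `p`-torsion
  is trivial, `primaryComponent_sha_eq_bot_of_inf_torsionBy_eq_bot`).
* §3 `natCard_primaryComponent_sha_two_eq_one_of_cmInert_prime_discr_of_pointSystem` — **ON H₂ with a
  prime Heegner field `K = ℚ(√−q)` and a Heegner point `y_K ∉ 2E(K)` of level `N_E`:
  `#Ш(E/K)[2^∞] = 1 = 4⁰`** — the `M₀ = 0` instance of the crux's conclusion — modulo exactly {the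
  point-system data `D` for `y_K` at `p = 2` on the CM-inert Kolyvagin primes, (tower), (desc-fin)}; the
  conjugation `c ≠ 1` (`exists_conj_of_isImaginaryQuadratic`) and the `2`-divisibility
  of `E(K̄)` (`zsmul_geomPoints_surjective_holds`) are supplied here.

Beyond print: NO as long as `D` is a hypothesis (Gross §§4–6 / McCallum §4 at `p = 2` for CM curves are
not in print and not in the tree — the pen's booking memo `BOOKING-TARGET-H2-levelzero.md` v2 §2 (0b)).
BSD is not proved by this.

References: [GrossLMS1991] Prop. 2.1 with §10, §4 (4.1), Props. 5.4, 6.2; [McCallumLMS1991] §1 Theorem,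
§2 Prop. 2.2, §5 Lemma 5.1, 5.3; [MilneADT2006] I Thm. 4.10 (b), Cor. 2.3; [SilvermanAEC2009] VIII §2,
X Thm. 4.2 (a); [Kolyvagin1989Izv] §3.
-/

-- single-conjunct summit: `Summit.BirchSwinnertonDyer.BirchSwinnertonDyer.…` repeats the name by design
set_option linter.dupNamespace false
set_option autoImplicit false

noncomputable section

open scoped Classical
open WeierstrassCurve NumberField IsDedekindDomain Field
open Literature.NumberTheory.GaloisRepresentations Literature.NumberTheory.EllipticCurves
open Literature.NumberTheory.GaloisCohomology
open Rat.HeightOneSpectrum (primesEquiv)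

namespace Summit.BirchSwinnertonDyer.BirchSwinnertonDyer.Theorems.KolyvaginRatDescentTwo

variable (W : WeierstrassCurve ℚ) {K : Type} [Field K] [NumberField K]

/-! ## §1 g8's `M₀ = 0` Selmer statement with Poitou–Tate and the reciprocity family DISCHARGED -/

/-- **ON H₂ with a prime Heegner field: `y_K ∉ 2E(K)` ⟹ `Sel₂(E/K) ⊆ {0, δ₂ y_K}`, modulo the
point-system data `D` and the two PLUMBING binders (tower), (desc-fin) ONLY** —
`…RationalDescentAtTwoDual.selmer_two_eq_zero_or_eq_kummer_of_cmInert_prime_discr_of_plumbing` with its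
Poitou–Tate hypothesis discharged by `PoitouTateReduction.poitouTate_selmerStructure_duality_real_holds ℚ`
and its reciprocity family by `KolyvaginReciprocityTwo.nonempty_reciprocityFamily_two_cmInert`.
[cite: GrossLMS1991, Prop. 2.1 with §10, Props. 5.4, 6.2] [cite: McCallumLMS1991, §2 Prop. 2.2, §3
Cor. 3.2, §5 Lemma 5.3] [cite: MilneADT2006, Ch. I, Thm. 4.10 (b) and Cor. 2.3] -/
theorem selmer_two_eq_zero_or_eq_kummer_of_cmInert_prime_discr_of_pointSystem [W.IsElliptic]
    [W.IsGloballyMinimal] [NeZero (W.conductorNorm ℤ)] (hCM : W.HasCM)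
    (hin : Literature.NumberTheory.EllipticCurves.Rank1Residual.CMInert W 2)
    (hsurj : W.HasSurjectiveModNGaloisRep 2) (hK : IsImaginaryQuadratic K) (hodd : Odd (discr K))
    (hH : SatisfiesHeegnerHypothesis (W.conductorNorm ℤ) K) {q : ℕ} (hq : q.Prime)
    (hd : discr K = -(q : ℤ)) (u : HeightOneSpectrum (𝓞 ℚ)) (hu : ((primesEquiv u : Nat.Primes) : ℕ) = q)
    {P : (W.baseChange K).toAffine.Point} (hP : IsHeegnerPoint (W.conductorNorm ℤ) W K P)
    {c : K ≃ₐ[ℚ] K} (hc : c ≠ 1) (hy : ∀ Q : (W.baseChange K).toAffine.Point, 2 • Q ≠ P)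
    (D : Rank1Residual.P2.KolyvaginMachine.PointSystemFamily (W.conductorNorm ℤ) W K P 2
      (Literature.NumberTheory.EllipticCurves.Rank1Residual.CMInert W))
    (hdiv : ∀ Q : geomPoints (W.baseChange K), ∃ R, ((2 ^ 1 : ℕ) : ℤ) • R = Q)
    (htower : ∀ (w : HeightOneSpectrum (𝓞 K)) (ξ : galH1Torsion W ((2 ^ 1 : ℕ) : ℤ)),
      ξ ∈ W.torsionLocalKer ((w.under (𝓞 ℚ)).adicCompletion ℚ) ((2 ^ 1 : ℕ) : ℤ) →
        resTorsion W K ((2 ^ 1 : ℕ) : ℤ) ξ ∈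
          (W.baseChange K).torsionLocalKer (w.adicCompletion K) ((2 ^ 1 : ℕ) : ℤ))
    (hdescfin : ∀ (ξ : galH1Torsion W ((2 ^ 1 : ℕ) : ℤ)) (v : HeightOneSpectrum (𝓞 ℚ)), v ≠ u →
      (∀ w : HeightOneSpectrum (𝓞 K), w.under (𝓞 ℚ) = v →
        resTorsion W K ((2 ^ 1 : ℕ) : ℤ) ξ ∈
          selmerLocalKer (W.baseChange K) (w.adicCompletion K) ((2 ^ 1 : ℕ) : ℤ)) →
      ξ ∈ selmerLocalKer W (v.adicCompletion ℚ) ((2 ^ 1 : ℕ) : ℤ)) :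
    ∀ s ∈ selmerGroup (W.baseChange K) ((2 ^ 1 : ℕ) : ℤ),
      s = 0 ∨ s = kummerMapTorsion (W.baseChange K) ((2 ^ 1 : ℕ) : ℤ) hdiv P := by
  obtain ⟨R⟩ := KolyvaginReciprocityTwo.nonempty_reciprocityFamily_two_cmInert W K
  exact selmer_two_eq_zero_or_eq_kummer_of_cmInert_prime_discr_of_plumbing W hCM hin hsurj hK hodd hH
    hq hd u hu (SchneiderFreeAdditiveX3.PoitouTateReduction.poitouTate_selmerStructure_duality_real_holds ℚ)
    hP hc hy D R hdiv htower hdescfin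

/-! ## §2 Generic: `Sel_p(E/K) ⊆ {0, δ_p P}` forces `#Ш(E/K)[p^∞] = 1` -/

/-- **`Sel_p(E/K) ⊆ {0, δ_p P}` ⟹ `#Ш(E/K)[p^∞] = 1`** for an elliptic curve over a number field, a
prime `p` and any point `P ∈ E(K)`: every Selmer class then dies in `H¹(K, E)` (the Kummer class does,
`torsionH1ToH1_kummerMapTorsion`), the image of `Sel_p` in `H¹(K, E)` is `Ш(E/K) ∩ H¹(K, E)[p]`
(Silverman X.4.2 (a), `map_torsionH1ToH1_selmerGroup_holds`), so `Ш(E/K)[p] = 0`, and a `p`-primary group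
without `p`-torsion is trivial (`primaryComponent_sha_eq_bot_of_inf_torsionBy_eq_bot`). The level is
written `p ^ 1` (the machine's currency). [cite: SilvermanAEC2009, X Thm. 4.2 (a) and VIII §2]
[cite: McCallumLMS1991, §1 Theorem (Kolyvagin) and §5 Lemma 5.1] -/
theorem natCard_primaryComponent_sha_eq_one_of_selmer_subset_pair {L : Type} [Field L] [NumberField L]
    (E : WeierstrassCurve L) [E.IsElliptic] (p : ℕ) [hp : Fact p.Prime]
    (hdiv : ∀ Q : geomPoints E, ∃ R, ((p ^ 1 : ℕ) : ℤ) • R = Q) (P : E.toAffine.Point)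
    (h : ∀ s ∈ selmerGroup E ((p ^ 1 : ℕ) : ℤ), s = 0 ∨ s = kummerMapTorsion E ((p ^ 1 : ℕ) : ℤ) hdiv P) :
    Nat.card (AddCommGroup.primaryComponent E.sha p) = 1 := by
  have hp1 : ((p ^ 1 : ℕ) : ℤ) = (p : ℤ) := by rw [pow_one]
  have hn : ((p ^ 1 : ℕ) : ℤ) ≠ 0 := by
    rw [hp1]; exact_mod_cast hp.out.ne_zero
  -- every Selmer class dies in `H¹(K, E)`
  have hker : ∀ s ∈ selmerGroup E ((p ^ 1 : ℕ) : ℤ), torsionH1ToH1 E ((p ^ 1 : ℕ) : ℤ) s = 0 := by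
    intro s hs
    rcases h s hs with h0 | hP
    · rw [h0, map_zero]
    · rw [hP]; exact torsionH1ToH1_kummerMapTorsion E _ hdiv P
  -- hence `Ш(E/K) ∩ H¹(K, E)[p] = 0`
  have hbot' : (E.sha ⊓ AddSubgroup.torsionBy E.galH1 ((p ^ 1 : ℕ) : ℤ) : AddSubgroup E.galH1) = ⊥ := by
    rw [← E.map_torsionH1ToH1_selmerGroup_holds hn, eq_bot_iff]
    rintro _ ⟨s, hs, rfl⟩
    exact (AddSubgroup.mem_bot).mpr (hker s hs)
  have hbot : (E.sha ⊓ AddSubgroup.torsionBy E.galH1 (p : ℤ) : AddSubgroup E.galH1) = ⊥ := by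
    rw [← hp1]; exact hbot'
  rw [AddSubgroup.card_eq_one]
  exact primaryComponent_sha_eq_bot_of_inf_torsionBy_eq_bot E p hbot

/-! ## §3 ON H₂, prime Heegner field, `y_K ∉ 2E(K)`: `#Ш(E/K)[2^∞] = 1` modulo {`D`, (tower), (desc-fin)} -/

/-- **THE `M₀ = 0` CASE OF THE CRUX ON H₂ FOR A PRIME HEEGNER FIELD, in the `Ш`-currency**: `W/ℚ` globally
minimal with CM, `2` inert in the CM field, `ρ̄_{W,2}` onto; `K = ℚ(√−q)` (`q` prime, `d_K = −q` odd) with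
the Heegner hypothesis for `N_E`; `P ∈ E(K)` a Heegner point of level `N_E` with `P ∉ 2E(K)`. GRANTED the
point-system DATA for `P` at `p = 2` on the CM-inert Kolyvagin primes (item (0b): Gross §§4–6 at `2`, not
print) and the PLUMBING binders (tower), (desc-fin): **`#Ш(E/K)[2^∞] = 1`** (`= 4^{M₀}`, `M₀ = 0`).
Poitou–Tate, Čebotarev, the reciprocity family, the conjugation of `K` and the `2`-divisibility of `E(K̄)`
are theorems of the tree and supplied here. [cite: GrossLMS1991, Prop. 2.1 with §10, Props. 5.4, 6.2]
[cite: McCallumLMS1991, §1 Theorem, §2 Prop. 2.2, §5 Lemma 5.1 and 5.3] [cite: SilvermanAEC2009, X Thm. 4.2 (a)] -/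
theorem natCard_primaryComponent_sha_two_eq_one_of_cmInert_prime_discr_of_pointSystem [W.IsElliptic]
    [W.IsGloballyMinimal] [NeZero (W.conductorNorm ℤ)] (hCM : W.HasCM)
    (hin : Literature.NumberTheory.EllipticCurves.Rank1Residual.CMInert W 2)
    (hsurj : W.HasSurjectiveModNGaloisRep 2) (hK : IsImaginaryQuadratic K) (hodd : Odd (discr K))
    (hH : SatisfiesHeegnerHypothesis (W.conductorNorm ℤ) K) {q : ℕ} (hq : q.Prime)
    (hd : discr K = -(q : ℤ)) (u : HeightOneSpectrum (𝓞 ℚ)) (hu : ((primesEquiv u : Nat.Primes) : ℕ) = q)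
    {P : (W.baseChange K).toAffine.Point} (hP : IsHeegnerPoint (W.conductorNorm ℤ) W K P)
    (hy : ∀ Q : (W.baseChange K).toAffine.Point, 2 • Q ≠ P)
    (D : Rank1Residual.P2.KolyvaginMachine.PointSystemFamily (W.conductorNorm ℤ) W K P 2
      (Literature.NumberTheory.EllipticCurves.Rank1Residual.CMInert W))
    (htower : ∀ (w : HeightOneSpectrum (𝓞 K)) (ξ : galH1Torsion W ((2 ^ 1 : ℕ) : ℤ)),
      ξ ∈ W.torsionLocalKer ((w.under (𝓞 ℚ)).adicCompletion ℚ) ((2 ^ 1 : ℕ) : ℤ) →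
        resTorsion W K ((2 ^ 1 : ℕ) : ℤ) ξ ∈
          (W.baseChange K).torsionLocalKer (w.adicCompletion K) ((2 ^ 1 : ℕ) : ℤ))
    (hdescfin : ∀ (ξ : galH1Torsion W ((2 ^ 1 : ℕ) : ℤ)) (v : HeightOneSpectrum (𝓞 ℚ)), v ≠ u →
      (∀ w : HeightOneSpectrum (𝓞 K), w.under (𝓞 ℚ) = v →
        resTorsion W K ((2 ^ 1 : ℕ) : ℤ) ξ ∈
          selmerLocalKer (W.baseChange K) (w.adicCompletion K) ((2 ^ 1 : ℕ) : ℤ)) →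
      ξ ∈ selmerLocalKer W (v.adicCompletion ℚ) ((2 ^ 1 : ℕ) : ℤ)) :
    Nat.card (AddCommGroup.primaryComponent (W.baseChange K).sha 2) = 1 := by
  haveI : Fact (Nat.Prime 2) := ⟨Nat.prime_two⟩
  haveI hEK : (W.baseChange K).IsElliptic := inferInstanceAs (W.map (algebraMap ℚ K)).IsElliptic
  -- the complex conjugation of `K` and the `2`-divisibility of `E(K̄)`
  obtain ⟨c, hc, -⟩ := exists_conj_of_isImaginaryQuadratic (K := K) hK
  have hdiv : ∀ Q : geomPoints (W.baseChange K), ∃ R, ((2 ^ 1 : ℕ) : ℤ) • R = Q := fun Q ↦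
    (W.baseChange K).zsmul_geomPoints_surjective_holds (n := ((2 ^ 1 : ℕ) : ℤ)) (by norm_num) Q
  exact natCard_primaryComponent_sha_eq_one_of_selmer_subset_pair (W.baseChange K) 2 hdiv P
    (selmer_two_eq_zero_or_eq_kummer_of_cmInert_prime_discr_of_pointSystem W hCM hin hsurj hK hodd hH hq
      hd u hu hP hc hy D hdiv htower hdescfin)

end Summit.BirchSwinnertonDyer.BirchSwinnertonDyer.Theorems.KolyvaginRatDescentTwo

end
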